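import Mathlib
import Literature.NumberTheory.Sieve.QuadraticRootsPrimeModuliDFISieveEstimates
import Literature.NumberTheory.Sieve.BombieriFriedlanderIwaniecTheorem5Reciprocity
import HarnessLib

/-!
# The main term of a Linnik dispersion with Möbius coefficients — elementary preliminaries

Topic `Literature/NumberTheory/Sieve`.  Everything in this file is PROVED (theorems only).

Elementary divisor-sum and block-sum facts used in `DispersionMoebiusMainTerm.lean` to bound the main term
(frequency `0` after Poisson summation) of a dispersion `𝒟 = Σ_d F(d) |Σ_u α_u Σ_m 1[u ∣ A d m + B]|²` whose
coefficients `α_u = μ(tu) log(tu)/L` carry the Möbius function: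

* harmonic sums over a dyadic block and over the multiples of `d` in a block (`sum_inv_block_le_two`,
  `sum_filter_dvd_Ioc_eq`, `abs_sum_dvd_div_le`);
* `gcd(u,u') = Σ_{e ∣ u, e ∣ u'} φ(e)` and the exchange of `Σ_{u,u'}` against a sum over common divisors
  (`gcd_eq_sum_totient`, `sum_sum_inter_divisors_eq`);
* the coefficient identity `μ(tdw)·[…] = μ(td)·[…]·μ(w)·[(w, tdGM) = 1]` (`coeff_identity`);
* Möbius inversion of `h_k(n) = n·1[n ∣ k]` on the gcd with `|(μ ⋆ h_k)(d)| ≤ σ(gcd(d,k))`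
  (`exists_moebius_inversion_gcd`) and the bounds `Σ_d σ(gcd(d,n))/d² ≤ 2τ(n)`, tail `≤ 2τ(n)/D₀`;
* `Σ_{y ≠ y' ∈ (y₁,y₂]} τ(|y − y'|) ≤ 2Y²(1 + log Y)` (from the tree's `DFI1995.sum_card_divisors_le`;
  `Σ_{d} 1/d² ≤ 2` is the tree's `BFI.sum_Icc_one_div_sq_le_two`).

## References
* E. Bombieri, J. B. Friedlander, H. Iwaniec, Acta Math. 156 (1986), §§3–4 (dispersion main terms). [folklore]
* H. L. Montgomery, R. C. Vaughan, *Multiplicative Number Theory I*, CUP 2007, §§2.1, 8.1. [folklore]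
-/

noncomputable section

open Finset Real ArithmeticFunction
open scoped ArithmeticFunction.Moebius ArithmeticFunction.sigma ArithmeticFunction.zeta

namespace Literature.NumberTheory.Sieve

namespace DispersionMainTerm

/-! ### §1 Harmonic sums over a dyadic block -/

/-- Over a block `(V, 2V']` with `V' ≤ V`… precisely: if `U₂ ≤ 2U₁` then for every `r ≥ 1`,
`∑_{U₁/r < w ≤ U₂/r} 1/w ≤ 2` (the `w` run over `(⌊U₁/r⌋, ⌊U₂/r⌋]`). [folklore] -/
theorem sum_inv_block_le_two {U₁ U₂ r : ℕ} (hU : U₂ ≤ 2 * U₁) (hr : 0 < r) :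
    ∑ w ∈ Finset.Ioc (U₁ / r) (U₂ / r), (1 : ℝ) / w ≤ 2 := by
  -- every term is `≤ 1/(U₁/r + 1)` and there are `≤ U₂/r - U₁/r ≤ U₁/r + 1 + 1`… we use the cruder
  -- `#terms ≤ 2 (U₁/r + 1)` hmm; cleanest: each term ≤ 1/(U₁/r + 1), number of terms ≤ U₂/r - U₁/r ≤ 2(U₁/r) + 2 - U₁/r
  set a := U₁ / r with ha
  set b := U₂ / r with hb
  have hb2 : b ≤ 2 * a + 1 := by
    -- `U₂/r ≤ (2U₁)/r ≤ 2(U₁/r) + 1`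
    have h1 : U₂ / r ≤ (2 * U₁) / r := Nat.div_le_div_right hU
    have h2 : (2 * U₁) / r ≤ 2 * (U₁ / r) + 1 := by
      have := Nat.div_add_mod U₁ r
      have hm : U₁ % r < r := Nat.mod_lt _ hr
      have : 2 * U₁ = (2 * (U₁ / r)) * r + 2 * (U₁ % r) := by
        nth_rw 1 [← Nat.div_add_mod U₁ r]; ring
      rw [this, Nat.add_comm, Nat.add_mul_div_right _ _ hr]
      have : 2 * (U₁ % r) / r < 2 := Nat.div_lt_of_lt_mul (by omega)
      omega
    omega
  rcases Nat.lt_or_ge a b with hab | hab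
  · calc ∑ w ∈ Finset.Ioc a b, (1 : ℝ) / w ≤ ∑ w ∈ Finset.Ioc a b, (1 : ℝ) / (a + 1) := by
          refine Finset.sum_le_sum fun w hw => ?_
          have hw' := Finset.mem_Ioc.mp hw
          have : (a : ℝ) + 1 ≤ w := by exact_mod_cast hw'.1
          exact one_div_le_one_div_of_le (by positivity) this
      _ = ((b - a : ℕ) : ℝ) / (a + 1) := by
          rw [Finset.sum_const, Nat.card_Ioc, nsmul_eq_mul]; ring
      _ ≤ 2 := by
          rw [div_le_iff₀ (by positivity)]
          have : ((b - a : ℕ) : ℝ) ≤ a + 1 := by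
            have : b - a ≤ a + 1 := by omega
            exact_mod_cast this
          linarith
  · rw [Finset.Ioc_eq_empty (by omega), Finset.sum_empty]; norm_num

/-! ### §2 The divisor-sum identities used to decouple `u` and `u'` -/

/-- `gcd(u,u') = Σ_{e ∣ u, e ∣ u'} φ(e)` for `u, u' ≥ 1` (Gauss). [folklore] -/
theorem gcd_eq_sum_totient {u u' : ℕ} (hu : 0 < u) (hu' : 0 < u') :
    (Nat.gcd u u' : ℝ) = ∑ e ∈ (u.divisors ∩ u'.divisors), (Nat.totient e : ℝ) := by
  have hg : 0 < Nat.gcd u u' := Nat.gcd_pos_of_pos_left _ hu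
  have h := Nat.sum_totient (Nat.gcd u u')
  have hset : (Nat.gcd u u').divisors = u.divisors ∩ u'.divisors := by
    ext e
    simp only [Nat.mem_divisors, Finset.mem_inter, Nat.dvd_gcd_iff, ne_eq, hg.ne', not_false_eq_true,
      and_true, hu.ne', hu'.ne']
  rw [← hset]
  exact_mod_cast h.symm

/-- Tail `∑_{M < d ≤ X} 1/d² ≤ 1/M` for `M ≥ 1`. [folklore] -/
theorem sum_inv_sq_tail_le {M X : ℕ} (hM : 1 ≤ M) :
    ∑ d ∈ Finset.Ioc M X, (1 : ℝ) / (d : ℝ) ^ 2 ≤ 1 / M := by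
  induction X with
  | zero => simp
  | succ X ih =>
    rcases Nat.lt_or_ge X M with hXM | hXM
    · rw [Finset.Ioc_eq_empty (by omega), Finset.sum_empty]; positivity
    · -- `∑_{M<d≤X+1} ≤ 1/M - 1/(X+1) + 1/(X+1)²`… use the sharper invariant `≤ 1/M - 1/X`
      have key : ∀ n : ℕ, M ≤ n → ∑ d ∈ Finset.Ioc M n, (1 : ℝ) / (d : ℝ) ^ 2 ≤ 1 / M - 1 / n := by
        intro n hn
        induction n with
        | zero =>
          have : M = 0 := by omega
          omega
        | succ n ih2 =>
          rcases Nat.eq_or_lt_of_le hn with heq | hlt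
          · rw [← heq, Finset.Ioc_self, Finset.sum_empty, sub_self]
          · rw [Finset.sum_Ioc_succ_top (by omega)]
            have := ih2 (by omega)
            have hn1 : (1 : ℝ) ≤ n := by exact_mod_cast (show 1 ≤ n by omega)
            have hrec : (1 : ℝ) / ((n + 1 : ℕ) : ℝ) ^ 2 ≤ 1 / (n : ℝ) - 1 / ((n + 1 : ℕ) : ℝ) := by
              push_cast
              rw [div_sub_div _ _ (by positivity) (by positivity), div_le_div_iff₀ (by positivity) (by positivity)]
              nlinarith
            push_cast at hrec this ⊢
            linarith
      have := key (X + 1) (by omega)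
      have : (0 : ℝ) ≤ 1 / ((X + 1 : ℕ) : ℝ) := by positivity
      push_cast at *
      linarith

/-! ### §3 Multiples of `d` in a block; the trivial bound for the inner sums -/

/-- The multiples of `d ≥ 1` in `(U₁, U₂]` are `d·w`, `w ∈ (U₁/d, U₂/d]`. [folklore] -/
theorem filter_dvd_Ioc_eq_image {U₁ U₂ d : ℕ} (hd : 0 < d) :
    (Finset.Ioc U₁ U₂).filter (fun u => d ∣ u) = (Finset.Ioc (U₁ / d) (U₂ / d)).image (fun w => d * w) := by
  ext u
  simp only [Finset.mem_filter, Finset.mem_Ioc, Finset.mem_image]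
  constructor
  · rintro ⟨⟨h1, h2⟩, w, rfl⟩
    refine ⟨w, ⟨?_, ?_⟩, rfl⟩
    · exact (Nat.div_lt_iff_lt_mul hd).mpr (by rw [mul_comm]; exact h1)
    · exact (Nat.le_div_iff_mul_le hd).mpr (by rw [mul_comm]; exact h2)
  · rintro ⟨w, ⟨h1, h2⟩, rfl⟩
    refine ⟨⟨?_, ?_⟩, dvd_mul_right d w⟩
    · have := (Nat.div_lt_iff_lt_mul hd).mp h1; rw [mul_comm] at this; exact this
    · have := (Nat.le_div_iff_mul_le hd).mp h2; rw [mul_comm] at this; exact this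

/-- Sums over the multiples of `d` in a block. [folklore] -/
theorem sum_filter_dvd_Ioc_eq {U₁ U₂ d : ℕ} (hd : 0 < d) (f : ℕ → ℝ) :
    ∑ u ∈ (Finset.Ioc U₁ U₂).filter (fun u => d ∣ u), f u = ∑ w ∈ Finset.Ioc (U₁ / d) (U₂ / d), f (d * w) := by
  rw [filter_dvd_Ioc_eq_image hd, Finset.sum_image]
  intro a _ b _ hab
  exact Nat.eq_of_mul_eq_mul_left hd hab

/-- **Trivial bound**: for weights `|a u| ≤ 1`, `|∑_{U₁ < u ≤ U₂, d ∣ u} a(u)/u| ≤ 2/d` when `U₂ ≤ 2U₁`. [folklore] -/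
theorem abs_sum_dvd_div_le {U₁ U₂ d : ℕ} (hU : U₂ ≤ 2 * U₁) (hd : 0 < d) {a : ℕ → ℝ}
    (s : Finset ℕ) (hs : s ⊆ Finset.Ioc U₁ U₂) (ha : ∀ u ∈ s, |a u| ≤ 1) :
    |∑ u ∈ s.filter (fun u => d ∣ u), a u / u| ≤ 2 / d := by
  calc |∑ u ∈ s.filter (fun u => d ∣ u), a u / u|
      ≤ ∑ u ∈ s.filter (fun u => d ∣ u), |a u / u| := Finset.abs_sum_le_sum_abs _ _
    _ ≤ ∑ u ∈ s.filter (fun u => d ∣ u), (1 : ℝ) / u := by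
        refine Finset.sum_le_sum fun u hu => ?_
        have hus : u ∈ s := (Finset.mem_filter.mp hu).1
        rw [abs_div, Nat.abs_cast]
        have hu0 : (0 : ℝ) < u := by
          have := (Finset.mem_Ioc.mp (hs hus)).1
          exact_mod_cast (show 0 < u by omega)
        exact div_le_div_of_nonneg_right (ha u hus) hu0.le
    _ ≤ ∑ u ∈ (Finset.Ioc U₁ U₂).filter (fun u => d ∣ u), (1 : ℝ) / u :=
        Finset.sum_le_sum_of_subset_of_nonneg (Finset.filter_subset_filter _ hs) (fun _ _ _ => by positivity)
    _ = ∑ w ∈ Finset.Ioc (U₁ / d) (U₂ / d), (1 : ℝ) / d * ((1 : ℝ) / w) := by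
        rw [sum_filter_dvd_Ioc_eq hd]
        refine Finset.sum_congr rfl fun w _ => ?_
        push_cast; ring
    _ ≤ (1 : ℝ) / d * 2 := by
        rw [← Finset.mul_sum]
        exact mul_le_mul_of_nonneg_left (sum_inv_block_le_two hU hd) (by positivity)
    _ = 2 / d := by ring

/-! ### §4 The Möbius function of a product and the coefficient identity -/

/-- `μ(ab) = μ(a)μ(b)` if `(a,b) = 1`, and `μ(ab) = 0` otherwise. [folklore] -/
theorem moebius_mul_eq (a b : ℕ) : (μ (a * b) : ℤ) = if a.Coprime b then μ a * μ b else 0 := by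
  split_ifs with h
  · exact ArithmeticFunction.isMultiplicative_moebius.map_mul_of_coprime h
  · obtain ⟨p, hp, hpa, hpb⟩ := Nat.Prime.not_coprime_iff_dvd.mp h
    apply ArithmeticFunction.moebius_eq_zero_of_not_squarefree
    intro hsq
    have : p * p ∣ a * b := Nat.mul_dvd_mul hpa hpb
    exact hp.not_isUnit (hsq p this)

/-- **The coefficient identity.**  For `t, d, G ≥ 1`, `w ≥ 1` and an integer `m ≠ 0` (`M = |m|`):
`[dw squarefree ∧ (dw,G)=1 ∧ (M,dw)=1]·μ(tdw) = [d squarefree ∧ (d,G)=1 ∧ (M,d)=1]·μ(td)·[(w, tdGM)=1]·μ(w)`. [folklore] -/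
theorem coeff_identity (t d G w M : ℕ) :
    (if Squarefree (d * w) ∧ (d * w).Coprime G ∧ M.Coprime (d * w) then (μ (t * d * w) : ℝ) else 0) =
      (if Squarefree d ∧ d.Coprime G ∧ M.Coprime d then (μ (t * d) : ℝ) else 0) *
        (if w.Coprime (t * d * G * M) then (μ w : ℝ) else 0) := by
  by_cases hcop : w.Coprime (t * d * G * M)
  · rw [if_pos hcop]
    have hwt : w.Coprime t := Nat.Coprime.coprime_dvd_right ⟨d * G * M, by ring⟩ hcop
    have hwd : w.Coprime d := Nat.Coprime.coprime_dvd_right ⟨t * G * M, by ring⟩ hcop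
    have hwG : w.Coprime G := Nat.Coprime.coprime_dvd_right ⟨t * d * M, by ring⟩ hcop
    have hwM : w.Coprime M := Nat.Coprime.coprime_dvd_right ⟨t * d * G, by ring⟩ hcop
    have htdw : (t * d).Coprime w := (Nat.Coprime.mul_left hwt.symm hwd.symm)
    have hμ : (μ (t * d * w) : ℤ) = μ (t * d) * μ w := by
      rw [moebius_mul_eq, if_pos htdw]
    by_cases hsw : Squarefree w
    · have hiff : (Squarefree (d * w) ∧ (d * w).Coprime G ∧ M.Coprime (d * w)) ↔
          (Squarefree d ∧ d.Coprime G ∧ M.Coprime d) := by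
        rw [Nat.squarefree_mul_iff]
        constructor
        · rintro ⟨⟨-, hsd, -⟩, hG', hM'⟩
          exact ⟨hsd, Nat.Coprime.coprime_mul_right hG', Nat.Coprime.coprime_mul_right_right hM'⟩
        · rintro ⟨hsd, hdG, hMd⟩
          exact ⟨⟨hwd.symm, hsd, hsw⟩, Nat.Coprime.mul_left hdG hwG, Nat.Coprime.mul_right hMd hwM.symm⟩
      by_cases hP : Squarefree d ∧ d.Coprime G ∧ M.Coprime d
      · rw [if_pos (hiff.mpr hP), if_pos hP]
        exact_mod_cast hμ
      · rw [if_neg (fun h => hP (hiff.mp h)), if_neg hP, zero_mul]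
    · -- `w` not squarefree: both sides vanish
      have hμw : (μ w : ℤ) = 0 := ArithmeticFunction.moebius_eq_zero_of_not_squarefree hsw
      have hl : ¬ (Squarefree (d * w) ∧ (d * w).Coprime G ∧ M.Coprime (d * w)) := by
        rintro ⟨hs, -, -⟩
        exact hsw (Nat.squarefree_mul_iff.mp hs).2.2
      rw [if_neg hl]
      simp [hμw]
  · rw [if_neg hcop, mul_zero]
    split_ifs with hl
    · obtain ⟨hs, hdwG, hMdw⟩ := hl
      obtain ⟨p, hp, hpw, hp2⟩ := Nat.Prime.not_coprime_iff_dvd.mp hcop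
      -- `p ∣ tdGM`: four cases
      have hcases : p ∣ t ∨ p ∣ d ∨ p ∣ G ∨ p ∣ M := by
        rcases (Nat.Prime.dvd_mul hp).mp hp2 with h | h
        · rcases (Nat.Prime.dvd_mul hp).mp h with h | h
          · rcases (Nat.Prime.dvd_mul hp).mp h with h | h
            · exact Or.inl h
            · exact Or.inr (Or.inl h)
          · exact Or.inr (Or.inr (Or.inl h))
        · exact Or.inr (Or.inr (Or.inr h))
      rcases hcases with h | h | h | h
      · -- `p ∣ t`, `p ∣ w` ⇒ `p² ∣ tdw`
        have : ¬ Squarefree (t * d * w) := by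
          intro hsq
          have : p * p ∣ t * d * w := by
            calc p * p ∣ t * w := Nat.mul_dvd_mul h hpw
              _ ∣ t * d * w := ⟨d, by ring⟩
          exact hp.not_isUnit (hsq p this)
        exact_mod_cast ArithmeticFunction.moebius_eq_zero_of_not_squarefree this
      · exfalso
        have : p * p ∣ d * w := Nat.mul_dvd_mul h hpw
        exact hp.not_isUnit (hs p this)
      · exfalso
        have h1 : p ∣ d * w := Dvd.dvd.mul_left hpw d
        have h2 : p ∣ Nat.gcd (d * w) G := Nat.dvd_gcd h1 h
        rw [Nat.coprime_iff_gcd_eq_one.mp hdwG, Nat.dvd_one] at h2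
        exact hp.one_lt.ne' h2
      · exfalso
        have h1 : p ∣ d * w := Dvd.dvd.mul_left hpw d
        have h2 : p ∣ Nat.gcd M (d * w) := Nat.dvd_gcd h h1
        rw [Nat.coprime_iff_gcd_eq_one.mp hMdw, Nat.dvd_one] at h2
        exact hp.one_lt.ne' h2
    · rfl

/-! ### §5 Coprimality with an integer; divisor sums `Σ σ(gcd(d,n))/d²`; Möbius inversion on the gcd -/

/-- `Int.gcd m n = 1` for a natural `n` is `Nat.Coprime |m| n`. [folklore] -/
theorem int_gcd_natCast_eq_one_iff (m : ℤ) (n : ℕ) : Int.gcd m n = 1 ↔ m.natAbs.Coprime n := by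
  rw [Int.gcd_eq_natAbs, Int.natAbs_natCast, Nat.coprime_iff_gcd_eq_one]

/-- For `n ≥ 1` and `d ≥ 1`: `(gcd d n).divisors = d.divisors ∩ n.divisors`. [folklore] -/
theorem divisors_gcd_eq_inter {d n : ℕ} (hd : 0 < d) (hn : 0 < n) :
    (Nat.gcd d n).divisors = d.divisors ∩ n.divisors := by
  have hg : 0 < Nat.gcd d n := Nat.gcd_pos_of_pos_left _ hd
  ext e
  simp only [Nat.mem_divisors, Finset.mem_inter, Nat.dvd_gcd_iff, ne_eq, hg.ne', not_false_eq_true,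
    and_true, hd.ne', hn.ne']

/-- `Σ_{1 ≤ d ≤ X} σ(gcd(d,n))/d² ≤ 2 τ(n)` for `n ≥ 1`. [folklore] -/
theorem sum_sigma_gcd_div_sq_le {n : ℕ} (hn : 0 < n) (X : ℕ) :
    ∑ d ∈ Finset.Icc 1 X, ((σ 1 (Nat.gcd d n) : ℕ) : ℝ) / (d : ℝ) ^ 2 ≤ 2 * (n.divisors.card : ℝ) := by
  have hstep : ∀ d ∈ Finset.Icc 1 X, ((σ 1 (Nat.gcd d n) : ℕ) : ℝ) / (d : ℝ) ^ 2 =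
      ∑ e ∈ n.divisors, if e ∣ d then (e : ℝ) / (d : ℝ) ^ 2 else 0 := by
    intro d hd
    have hd0 : 0 < d := (Finset.mem_Icc.mp hd).1
    rw [ArithmeticFunction.sigma_one_apply, divisors_gcd_eq_inter hd0 hn, Nat.cast_sum, Finset.sum_div,
      ← Finset.sum_filter]
    congr 1
    ext e
    simp only [Finset.mem_inter, Nat.mem_divisors, Finset.mem_filter, ne_eq, hd0.ne', not_false_eq_true, and_true]
    tauto
  rw [Finset.sum_congr rfl hstep, Finset.sum_comm]
  have hinner : ∀ e ∈ n.divisors, ∑ d ∈ Finset.Icc 1 X, (if e ∣ d then (e : ℝ) / (d : ℝ) ^ 2 else 0) ≤ 2 / e := by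
    intro e he
    have he0 : 0 < e := Nat.pos_of_mem_divisors he
    rw [← Finset.sum_filter, show Finset.Icc 1 X = Finset.Ioc 0 X from rfl, sum_filter_dvd_Ioc_eq he0]
    simp only [Nat.zero_div]
    calc ∑ w ∈ Finset.Ioc 0 (X / e), (e : ℝ) / ((e * w : ℕ) : ℝ) ^ 2
        = (1 / e) * ∑ w ∈ Finset.Icc 1 (X / e), (1 : ℝ) / (w : ℝ) ^ 2 := by
          rw [Finset.mul_sum, show Finset.Ioc 0 (X / e) = Finset.Icc 1 (X / e) from rfl]
          refine Finset.sum_congr rfl fun w hw => ?_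
          have hw0 : (0 : ℝ) < w := by exact_mod_cast (Finset.mem_Icc.mp hw).1
          have he0' : (0 : ℝ) < e := by exact_mod_cast he0
          push_cast; field_simp
      _ ≤ (1 / e) * 2 := mul_le_mul_of_nonneg_left (BFI.sum_Icc_one_div_sq_le_two _) (by positivity)
      _ = 2 / e := by ring
  calc ∑ e ∈ n.divisors, ∑ d ∈ Finset.Icc 1 X, (if e ∣ d then (e : ℝ) / (d : ℝ) ^ 2 else 0)
      ≤ ∑ e ∈ n.divisors, (2 : ℝ) / e := Finset.sum_le_sum hinner
    _ ≤ ∑ e ∈ n.divisors, (2 : ℝ) := by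
        refine Finset.sum_le_sum fun e he => ?_
        have : (1 : ℝ) ≤ e := by exact_mod_cast Nat.pos_of_mem_divisors he
        exact div_le_self (by norm_num) this
    _ = 2 * (n.divisors.card : ℝ) := by rw [Finset.sum_const, nsmul_eq_mul]; ring

/-- Tail version: `Σ_{D₀ < d ≤ X} σ(gcd(d,n))/d² ≤ 2 τ(n)/D₀` for `n, D₀ ≥ 1`. [folklore] -/
theorem sum_sigma_gcd_div_sq_tail_le {n D₀ : ℕ} (hn : 0 < n) (hD₀ : 1 ≤ D₀) (X : ℕ) :
    ∑ d ∈ Finset.Ioc D₀ X, ((σ 1 (Nat.gcd d n) : ℕ) : ℝ) / (d : ℝ) ^ 2 ≤ 2 * (n.divisors.card : ℝ) / D₀ := by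
  have hstep : ∀ d ∈ Finset.Ioc D₀ X, ((σ 1 (Nat.gcd d n) : ℕ) : ℝ) / (d : ℝ) ^ 2 =
      ∑ e ∈ n.divisors, if e ∣ d then (e : ℝ) / (d : ℝ) ^ 2 else 0 := by
    intro d hd
    have hd0 : 0 < d := by have := (Finset.mem_Ioc.mp hd).1; omega
    rw [ArithmeticFunction.sigma_one_apply, divisors_gcd_eq_inter hd0 hn, Nat.cast_sum, Finset.sum_div,
      ← Finset.sum_filter]
    congr 1
    ext e
    simp only [Finset.mem_inter, Nat.mem_divisors, Finset.mem_filter, ne_eq, hd0.ne', not_false_eq_true, and_true]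
    tauto
  rw [Finset.sum_congr rfl hstep, Finset.sum_comm]
  have hinner : ∀ e ∈ n.divisors, ∑ d ∈ Finset.Ioc D₀ X, (if e ∣ d then (e : ℝ) / (d : ℝ) ^ 2 else 0) ≤ 2 / D₀ := by
    intro e he
    have he0 : 0 < e := Nat.pos_of_mem_divisors he
    have he0' : (0 : ℝ) < e := by exact_mod_cast he0
    have hD₀' : (0 : ℝ) < D₀ := by exact_mod_cast hD₀
    rw [← Finset.sum_filter, sum_filter_dvd_Ioc_eq he0]
    have hrew : ∑ w ∈ Finset.Ioc (D₀ / e) (X / e), (e : ℝ) / ((e * w : ℕ) : ℝ) ^ 2 =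
        (1 / e) * ∑ w ∈ Finset.Ioc (D₀ / e) (X / e), (1 : ℝ) / (w : ℝ) ^ 2 := by
      rw [Finset.mul_sum]
      refine Finset.sum_congr rfl fun w hw => ?_
      have hw0 : (0 : ℝ) < w := by
        exact_mod_cast lt_of_le_of_lt (Nat.zero_le _) (Finset.mem_Ioc.mp hw).1
      push_cast; field_simp
    rw [hrew]
    rcases Nat.eq_zero_or_pos (D₀ / e) with hz | hp
    · -- `e > D₀`: the full sum is `≤ 2`, and `2/e < 2/D₀`
      have heD : D₀ < e := by
        by_contra h; push Not at h
        have : 1 ≤ D₀ / e := (Nat.le_div_iff_mul_le he0).mpr (by simpa using h)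
        omega
      rw [hz, show Finset.Ioc 0 (X / e) = Finset.Icc 1 (X / e) from rfl]
      calc (1 / (e : ℝ)) * ∑ w ∈ Finset.Icc 1 (X / e), (1 : ℝ) / (w : ℝ) ^ 2 ≤ (1 / e) * 2 :=
            mul_le_mul_of_nonneg_left (BFI.sum_Icc_one_div_sq_le_two _) (by positivity)
        _ ≤ 2 / D₀ := by
            rw [div_mul_eq_mul_div, one_mul]
            exact div_le_div_of_nonneg_left (by norm_num) hD₀' (by exact_mod_cast heD.le)
    · -- `e ≤ D₀`: tail `≤ 1/(D₀/e) ≤ 2e/D₀`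
      have htail := sum_inv_sq_tail_le (X := X / e) hp
      have hfl : (1 : ℝ) / ((D₀ / e : ℕ) : ℝ) ≤ 2 * e / D₀ := by
        -- `D₀ < e * (D₀/e + 1) ≤ 2 e (D₀/e)`
        have h1 : D₀ < e * (D₀ / e + 1) := Nat.lt_mul_div_succ D₀ he0
        have h2 : (D₀ : ℝ) < e * ((D₀ / e : ℕ) + 1) := by exact_mod_cast h1
        have h3 : (1 : ℝ) ≤ (D₀ / e : ℕ) := by exact_mod_cast hp
        rw [div_le_div_iff₀ (by positivity) hD₀']
        nlinarith
      calc (1 / (e : ℝ)) * ∑ w ∈ Finset.Ioc (D₀ / e) (X / e), (1 : ℝ) / (w : ℝ) ^ 2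
          ≤ (1 / e) * (2 * e / D₀) := mul_le_mul_of_nonneg_left (htail.trans hfl) (by positivity)
        _ = 2 / D₀ := by field_simp
  calc ∑ e ∈ n.divisors, ∑ d ∈ Finset.Ioc D₀ X, (if e ∣ d then (e : ℝ) / (d : ℝ) ^ 2 else 0)
      ≤ ∑ e ∈ n.divisors, (2 : ℝ) / D₀ := Finset.sum_le_sum hinner
    _ = 2 * (n.divisors.card : ℝ) / D₀ := by rw [Finset.sum_const, nsmul_eq_mul]; ring

/-- The arithmetic function `h_k(n) = n · 1[n ∣ k]` (`k ≠ 0`). [folklore] -/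
theorem exists_moebius_inversion_gcd (k : ℤ) (hk : k ≠ 0) :
    ∃ H : ℕ → ℝ, (∀ d, 0 < d → |H d| ≤ ((σ 1 (Nat.gcd d k.natAbs) : ℕ) : ℝ)) ∧
      ∀ u u' : ℕ, 0 < u → 0 < u' →
        (if ((Nat.gcd u u' : ℕ) : ℤ) ∣ k then ((Nat.gcd u u' : ℕ) : ℝ) else 0) =
          ∑ d ∈ u.divisors ∩ u'.divisors, H d := by
  classical
  -- `h` as an arithmetic function
  let hf : ArithmeticFunction ℝ :=
    ⟨fun n => if ((n : ℕ) : ℤ) ∣ k then (n : ℝ) else 0, by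
      simp only [Nat.cast_zero, Int.zero_dvd]; rw [if_neg hk]⟩
  let Hf : ArithmeticFunction ℝ := (μ : ArithmeticFunction ℝ) * hf
  refine ⟨fun d => Hf d, ?_, ?_⟩
  · intro d hd
    show |((μ : ArithmeticFunction ℝ) * hf) d| ≤ _
    rw [ArithmeticFunction.mul_apply]
    refine (Finset.abs_sum_le_sum_abs _ _).trans ?_
    rw [ArithmeticFunction.sigma_one_apply, Nat.cast_sum]
    -- compare the sum over the antidiagonal with the sum over divisors `b ∣ gcd(d,|k|)` of `b`
    rw [Nat.sum_divisorsAntidiagonal' (fun a b => |((μ : ArithmeticFunction ℝ) a) * hf b|)]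
    have hsub : ∀ b ∈ d.divisors, |((μ : ArithmeticFunction ℝ) (d / b)) * hf b| ≤
        if b ∣ k.natAbs then (b : ℝ) else 0 := by
      intro b hb
      show |((μ : ArithmeticFunction ℝ) (d / b)) * (if ((b : ℕ) : ℤ) ∣ k then (b : ℝ) else 0)| ≤ _
      have hiff : ((b : ℕ) : ℤ) ∣ k ↔ b ∣ k.natAbs := Int.natCast_dvd
      by_cases hbk : b ∣ k.natAbs
      · rw [if_pos (hiff.mpr hbk), if_pos hbk, abs_mul, Nat.abs_cast]
        have : |((μ : ArithmeticFunction ℝ) (d / b))| ≤ 1 := by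
          rw [ArithmeticFunction.intCoe_apply]
          exact_mod_cast ArithmeticFunction.abs_moebius_le_one
        calc |((μ : ArithmeticFunction ℝ) (d / b))| * (b : ℝ) ≤ 1 * b :=
              mul_le_mul_of_nonneg_right this (by positivity)
          _ = b := one_mul _
      · rw [if_neg (fun h => hbk (hiff.mp h)), if_neg hbk, mul_zero, abs_zero]
    refine (Finset.sum_le_sum hsub).trans ?_
    rw [← Finset.sum_filter]
    apply le_of_eq
    congr 1
    have hkpos : 0 < k.natAbs := Int.natAbs_pos.mpr hk
    rw [divisors_gcd_eq_inter hd hkpos]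
    ext b
    simp only [Finset.mem_filter, Finset.mem_inter, Nat.mem_divisors, ne_eq, hkpos.ne', not_false_eq_true, and_true]
  · intro u u' hu hu'
    have hg : 0 < Nat.gcd u u' := Nat.gcd_pos_of_pos_left _ hu
    have key : ((ζ : ArithmeticFunction ℝ) * Hf) (Nat.gcd u u') = hf (Nat.gcd u u') := by
      show ((ζ : ArithmeticFunction ℝ) * ((μ : ArithmeticFunction ℝ) * hf)) (Nat.gcd u u') = _
      rw [← mul_assoc, ArithmeticFunction.coe_zeta_mul_coe_moebius, one_mul]
    rw [ArithmeticFunction.coe_zeta_mul_apply, divisors_gcd_eq_inter hu hu'] at key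
    rw [key]
    rfl

/-! ### §6 Exchanging the double sum over `u, u'` against common divisors -/

/-- Swapping a double sum over `u, u'` in a block against a sum over common divisors. [folklore] -/
theorem sum_sum_inter_divisors_eq {U₁ U₂ : ℕ} (s : Finset ℕ) (hs : s ⊆ Finset.Ioc U₁ U₂)
    (F : ℕ → ℝ) (A A' : ℕ → ℝ) :
    ∑ u ∈ s, ∑ u' ∈ s, A u * A' u' * ∑ e ∈ u.divisors ∩ u'.divisors, F e =
      ∑ e ∈ Finset.Icc 1 U₂, F e * ((∑ u ∈ s.filter (fun u => e ∣ u), A u) *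
        (∑ u' ∈ s.filter (fun u => e ∣ u), A' u')) := by
  have hmem : ∀ u ∈ s, 0 < u ∧ u ≤ U₂ := fun u hu => by
    have := Finset.mem_Ioc.mp (hs hu); exact ⟨by omega, this.2⟩
  have hinner : ∀ u ∈ s, ∀ u' ∈ s, ∑ e ∈ u.divisors ∩ u'.divisors, F e =
      ∑ e ∈ Finset.Icc 1 U₂, if e ∣ u ∧ e ∣ u' then F e else 0 := by
    intro u hu u' hu'
    rw [← Finset.sum_filter]
    congr 1
    ext e
    simp only [Finset.mem_inter, Nat.mem_divisors, Finset.mem_filter, Finset.mem_Icc, ne_eq,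
      (hmem u hu).1.ne', (hmem u' hu').1.ne', not_false_eq_true, and_true]
    constructor
    · rintro ⟨h1, h2⟩
      exact ⟨⟨Nat.pos_of_dvd_of_pos h1 (hmem u hu).1, (Nat.le_of_dvd (hmem u hu).1 h1).trans (hmem u hu).2⟩, h1, h2⟩
    · rintro ⟨-, h1, h2⟩; exact ⟨h1, h2⟩
  calc ∑ u ∈ s, ∑ u' ∈ s, A u * A' u' * ∑ e ∈ u.divisors ∩ u'.divisors, F e
      = ∑ u ∈ s, ∑ u' ∈ s, ∑ e ∈ Finset.Icc 1 U₂, (if e ∣ u ∧ e ∣ u' then A u * A' u' * F e else 0) := by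
        refine Finset.sum_congr rfl fun u hu => Finset.sum_congr rfl fun u' hu' => ?_
        rw [hinner u hu u' hu', Finset.mul_sum]
        refine Finset.sum_congr rfl fun e _ => ?_
        split_ifs <;> ring
    _ = ∑ u ∈ s, ∑ e ∈ Finset.Icc 1 U₂, ∑ u' ∈ s, (if e ∣ u ∧ e ∣ u' then A u * A' u' * F e else 0) :=
        Finset.sum_congr rfl fun u _ => Finset.sum_comm
    _ = ∑ e ∈ Finset.Icc 1 U₂, ∑ u ∈ s, ∑ u' ∈ s, (if e ∣ u ∧ e ∣ u' then A u * A' u' * F e else 0) :=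
        Finset.sum_comm
    _ = ∑ e ∈ Finset.Icc 1 U₂, F e * ((∑ u ∈ s.filter (fun u => e ∣ u), A u) *
          (∑ u' ∈ s.filter (fun u => e ∣ u), A' u')) := by
        refine Finset.sum_congr rfl fun e _ => ?_
        rw [Finset.sum_filter, Finset.sum_filter, Finset.sum_mul_sum, Finset.mul_sum]
        refine Finset.sum_congr rfl fun u _ => ?_
        rw [Finset.mul_sum]
        refine Finset.sum_congr rfl fun u' _ => ?_
        by_cases hu : e ∣ u
        · by_cases hu' : e ∣ u'
          · rw [if_pos ⟨hu, hu'⟩, if_pos hu, if_pos hu']; ring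
          · rw [if_neg (fun h => hu' h.2), if_pos hu, if_neg hu']; ring
        · rw [if_neg (fun h => hu h.1), if_neg hu]; ring

/-! ### §7 Counting: `⌊√U₁⌋`, and the pairs `(y, y')` off the diagonal -/

/-- `1/√U₁ ≥ 1/(2 · Nat.sqrt U₁)`: `Nat.sqrt U₁ ≥ √U₁/2` for `U₁ ≥ 1`. [folklore] -/
theorem inv_nat_sqrt_le {U₁ : ℕ} (hU₁ : 1 ≤ U₁) : (1 : ℝ) / (Nat.sqrt U₁ : ℝ) ≤ 2 / Real.sqrt U₁ := by
  have hD : 1 ≤ Nat.sqrt U₁ := Nat.le_sqrt.mpr (by simpa using hU₁)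
  have hlt : Real.sqrt U₁ < (Nat.sqrt U₁ : ℝ) + 1 := by
    have h := Nat.lt_succ_sqrt' U₁
    have h' : (U₁ : ℝ) < ((Nat.sqrt U₁ : ℝ) + 1) ^ 2 := by exact_mod_cast h
    calc Real.sqrt U₁ < Real.sqrt (((Nat.sqrt U₁ : ℝ) + 1) ^ 2) := Real.sqrt_lt_sqrt (by positivity) h'
      _ = (Nat.sqrt U₁ : ℝ) + 1 := Real.sqrt_sq (by positivity)
  have hD' : (1 : ℝ) ≤ Nat.sqrt U₁ := by exact_mod_cast hD
  have hs0 : 0 < Real.sqrt U₁ := Real.sqrt_pos.mpr (by exact_mod_cast hU₁)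
  rw [div_le_div_iff₀ (by positivity) hs0]
  linarith

/-- For a finite set `s` of integers contained in an interval of length `Y`… precisely for `s = (y₁, y₂]`:
`Σ_{y ≠ y' ∈ s} τ(|y − y'|) ≤ 2 Y · Y (1 + log Y)`, `Y = y₂ − y₁`. [folklore] -/
theorem sum_offDiag_card_divisors_le {y₁ y₂ : ℤ} (hy : y₁ ≤ y₂) :
    ∑ p ∈ (Finset.Ioc y₁ y₂).offDiag, (((p.1 - p.2).natAbs).divisors.card : ℝ) ≤
      2 * ((y₂ - y₁ : ℤ) : ℝ) * (((y₂ - y₁ : ℤ) : ℝ) * (1 + Real.log ((y₂ - y₁ : ℤ) : ℝ))) := by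
  set s : Finset ℤ := Finset.Ioc y₁ y₂ with hsdef
  set Y : ℕ := (y₂ - y₁).toNat with hYdef
  have hYZ : ((Y : ℕ) : ℤ) = y₂ - y₁ := Int.toNat_of_nonneg (sub_nonneg.mpr hy)
  have hYR : ((y₂ - y₁ : ℤ) : ℝ) = (Y : ℝ) := by rw [← hYZ]; simp
  have hscard : s.card = Y := by rw [hsdef, Int.card_Ioc]
  rw [hYR]
  -- offDiag ⊆ product; sum over `p.1 ∈ s` of the inner sums
  have h1 : ∑ p ∈ s.offDiag, (((p.1 - p.2).natAbs).divisors.card : ℝ) ≤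
      ∑ y ∈ s, ∑ y' ∈ s.erase y, (((y - y').natAbs).divisors.card : ℝ) := by
    rw [Finset.sum_sigma']
    apply le_of_eq
    refine Finset.sum_nbij' (fun p => ⟨p.1, p.2⟩) (fun q => (q.1, q.2)) ?_ ?_ ?_ ?_ ?_
    · intro p hp
      rw [Finset.mem_offDiag] at hp
      simp only [Finset.mem_sigma, Finset.mem_erase]
      exact ⟨hp.1, fun h => hp.2.2 h.symm, hp.2.1⟩
    · intro q hq
      simp only [Finset.mem_sigma, Finset.mem_erase] at hq
      rw [Finset.mem_offDiag]
      exact ⟨hq.1, hq.2.2, fun h => hq.2.1 h.symm⟩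
    · intro p _; rfl
    · intro q _; rfl
    · intro p _; rfl
  refine h1.trans ?_
  -- inner bound: fibres of `y' ↦ |y - y'|` have size ≤ 2, values in `[1, Y]`
  have hinner : ∀ y ∈ s, ∑ y' ∈ s.erase y, (((y - y').natAbs).divisors.card : ℝ) ≤
      2 * ((Y : ℝ) * (1 + Real.log (Y : ℝ))) := by
    intro y hy'
    have hvals : ∀ y' ∈ s.erase y, (y - y').natAbs ∈ Finset.Icc 1 Y := by
      intro y' hy''
      rw [Finset.mem_erase] at hy''
      have hys := Finset.mem_Ioc.mp hy'
      have hy's := Finset.mem_Ioc.mp hy''.2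
      rw [Finset.mem_Icc]
      constructor
      · exact Int.natAbs_pos.mpr (sub_ne_zero.mpr (fun h => hy''.1 h.symm))
      · have : ((y - y').natAbs : ℤ) ≤ Y := by
          rw [hYZ, Int.natCast_natAbs, abs_le]; constructor <;> linarith
        exact_mod_cast this
    rw [Finset.sum_comp (fun r : ℕ => ((r.divisors.card : ℕ) : ℝ)) (fun y' : ℤ => (y - y').natAbs)]
    have hfib : ∀ r ∈ (s.erase y).image (fun y' : ℤ => (y - y').natAbs),
        (((s.erase y).filter (fun y' => (y - y').natAbs = r)).card : ℝ) ≤ 2 := by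
      intro r _
      have hsub : (s.erase y).filter (fun y' => (y - y').natAbs = r) ⊆ {y - r, y + r} := by
        intro y' hy''
        rw [Finset.mem_filter] at hy''
        have h := hy''.2
        rw [Finset.mem_insert, Finset.mem_singleton]
        rcases Int.natAbs_eq (y - y') with h' | h'
        · left; rw [h] at h'; linarith
        · right; rw [h] at h'; linarith
      calc (((s.erase y).filter (fun y' => (y - y').natAbs = r)).card : ℝ)
          ≤ (({y - r, y + r} : Finset ℤ).card : ℝ) := by exact_mod_cast Finset.card_le_card hsub
        _ ≤ 2 := by exact_mod_cast Finset.card_le_two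
    calc ∑ r ∈ (s.erase y).image (fun y' : ℤ => (y - y').natAbs),
          ((s.erase y).filter (fun y' => (y - y').natAbs = r)).card • ((r.divisors.card : ℕ) : ℝ)
        ≤ ∑ r ∈ (s.erase y).image (fun y' : ℤ => (y - y').natAbs), 2 * ((r.divisors.card : ℕ) : ℝ) := by
          refine Finset.sum_le_sum fun r hr => ?_
          rw [nsmul_eq_mul]
          exact mul_le_mul_of_nonneg_right (hfib r hr) (by positivity)
      _ ≤ ∑ r ∈ Finset.Icc 1 Y, 2 * ((r.divisors.card : ℕ) : ℝ) := by
          refine Finset.sum_le_sum_of_subset_of_nonneg ?_ (fun _ _ _ => by positivity)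
          intro r hr
          obtain ⟨y', hy'', rfl⟩ := Finset.mem_image.mp hr
          exact hvals y' hy''
      _ = 2 * ∑ r ∈ Finset.Icc 1 Y, ((r.divisors.card : ℕ) : ℝ) := by rw [Finset.mul_sum]
      _ ≤ 2 * ((Y : ℝ) * (1 + Real.log (Y : ℝ))) :=
          mul_le_mul_of_nonneg_left (DFI1995.sum_card_divisors_le Y) (by norm_num)
  calc ∑ y ∈ s, ∑ y' ∈ s.erase y, (((y - y').natAbs).divisors.card : ℝ)
      ≤ ∑ y ∈ s, 2 * ((Y : ℝ) * (1 + Real.log (Y : ℝ))) := Finset.sum_le_sum hinner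
    _ = 2 * (Y : ℝ) * ((Y : ℝ) * (1 + Real.log (Y : ℝ))) := by
        rw [Finset.sum_const, hscard, nsmul_eq_mul]; ring

end DispersionMainTerm

end Literature.NumberTheory.Sieve
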